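import Summits.HubbardSuperconductivity.HubbardSuperconductivity.Theorems.AnisotropyChordTransferFibre3FinX3Eval
import Summits.HubbardSuperconductivity.HubbardSuperconductivity.Theorems.AnisotropyChordTransferFibre3FinXC2Cover
import Summits.HubbardSuperconductivity.HubbardSuperconductivity.Theorems.AnisotropyChordTransferFibre3C0Layer

/-!
# Route `AnisotropyChord` / H0 rotor rung: FIN per-`L` GM₃ (X3, `L ≥ 25`) — the combined cell with the `T⁺ − 3λ₂` export is sound

Soundness of `…FinX3Eval.xbcnCellOK2` / `xbcnCellAny2`: a passing combined XBC2 cell fact with the literal bracket `nt` gives, for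
every ground two-magnon profile of the λ-cell (`0 < Δ ≤ Δ₁ < 1`), g5's `CellConclusion` (row `N₁` with constant `c` and the row-C
bracket tuple with `b = bn/bd`, by g6's `xbc2_cell_sound`) AND `T⁺ − 3λ₂ ∈ nt` (from the XB2 object enclosures `mem_objP/Q` and
`sum_piR_C0fn`): ★ `xbcn_cell_sound`, ★ `xbcn_cellAny_sound`.  The exported bracket is what the X3 row-D and side-condition cells read.
Prover seat `hubbard-h0-rotor-p3` g8; helper for piece A = stmt-HubbardSuperconductivity-23918 of rung 19089 (`--supports`, helper
class).  WHAT THIS IS NOT: nothing here proves superconductivity in the Hubbard model (rotor TARGET as worded stays FALSE, g15 verdict);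
two hypotheses (rows `N₁`, C per `L` per cell) of ONE conditional reduction.  Tree imports only; no sorry, no new axioms.
-/

set_option linter.dupNamespace false
set_option autoImplicit false

namespace Summit.HubbardSuperconductivity.HubbardSuperconductivity.Theorems.AnisotropyChord.Transfer.Fibre3

namespace FinXB

open scoped BigOperators
open Finset Hole2 FinCell

variable {L : ℕ} [NeZero L]

/-- ★ THE COMBINED X3 CELL CERTIFICATE IS SOUND: `CellConclusion` (rows `N₁` + C) and `T⁺ − 3λ₂ ∈ nt` for every ground profile of
the cell. [folklore] -/
theorem xbcn_cell_sound (hL : 5 ≤ L) {Δ lam2 : ℝ} (hΔ0 : 0 < Δ) (hΔ1 : Δ < 1) {f : Tor L → ℝ}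
    (hf : IsGroundTwoMagnon L Δ lam2 f) {la lb : ℤ}
    (hla : (la : ℝ) ≤ lam2 * ((D : ℤ) : ℝ)) (hlb : lam2 * ((D : ℤ) : ℝ) ≤ (lb : ℝ))
    {c : ℚ} {bn bd : ℕ} {nt : Iv} (hcert : xbcnCellOK2 L la lb c bn bd nt (tWedgePt L la) (tWedgePt L lb) = true) :
    CellConclusion L Δ lam2 f c bn bd ∧ mem (Tplus L Δ f - 3 * lam2) nt := by
  unfold xbcnCellOK2 at hcert
  simp only [Bool.and_eq_true, decide_eq_true_eq] at hcert
  obtain ⟨hc, hn1, hn2⟩ := hcert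
  refine ⟨xbc2_cell_sound hL hΔ0 hΔ1 hf hla hlb hc, ?_⟩
  have hc' := hc
  unfold xbcCellOK2 at hc'
  simp only [Bool.and_eq_true, decide_eq_true_eq] at hc'
  obtain ⟨⟨⟨⟨⟨⟨hchk, hsc⟩, hna⟩, hP⟩, -⟩, -⟩, -⟩ := hc'
  have H : CellHyp2 (L := L) Δ lam2 f la lb := ⟨⟨hL, hΔ0.le, hΔ1, hf, hla, hlb, hchk, hsc⟩, hna⟩
  have mP := H.mem_objP
  have mQ := H.mem_objQ
  have hPpos : 0 < PiNormSq L f := by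
    have h1 : (0 : ℝ) < ((xbEval2 L la lb (tWedgePt L la) (tWedgePt L lb)).2.P.1 : ℝ) := by exact_mod_cast hP
    nlinarith [mP.1, D_pos]
  have hid := sum_piR_C0fn L hf.1
  have e : Tplus L Δ f - 3 * lam2 = (∑ cc : Cfg L, piR L f cc * C0fn L Δ lam2 f cc) * (1 / PiNormSq L f) := by
    rw [hid]; field_simp
  have m : mem (Tplus L Δ f - 3 * lam2) (ntOf2 L la lb (tWedgePt L la) (tWedgePt L lb)) := by
    unfold ntOf2
    rw [e]
    exact mem_imul mQ (mem_iinv mP hP)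
  obtain ⟨m1, m2⟩ := m
  have h1 : ((nt.1 : ℤ) : ℝ) ≤ (((ntOf2 L la lb (tWedgePt L la) (tWedgePt L lb)).1 : ℤ) : ℝ) := by exact_mod_cast hn1
  have h2 : (((ntOf2 L la lb (tWedgePt L la) (tWedgePt L lb)).2 : ℤ) : ℝ) ≤ ((nt.2 : ℤ) : ℝ) := by exact_mod_cast hn2
  exact ⟨h1.trans m1, m2.trans h2⟩

/-- ★ one cell of the combined X3 certificate: vacuous branches are contradictory at `0 < Δ ≤ Δ₁`, the certified branch gives
`CellConclusion` and `T⁺ − 3λ₂ ∈ nt`. [folklore] -/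
theorem xbcn_cellAny_sound (L : ℕ) [NeZero L] (hL : 5 ≤ L) {d1 : ℚ} {bd : ℕ} {Δ lam2 : ℝ} (hΔ0 : 0 < Δ)
    (hΔd : Δ ≤ (d1 : ℝ)) (hΔ1 : Δ < 1) {f : Tor L → ℝ} (hf : IsGroundTwoMagnon L Δ lam2 f) {la lb : ℤ}
    (hla : (la : ℝ) ≤ lam2 * ((D : ℤ) : ℝ)) (hlb : lam2 * ((D : ℤ) : ℝ) ≤ (lb : ℝ)) {cb : ℚ × ℕ} {nt : Iv}
    (hok : xbcnCellAny2 L d1 bd la lb cb nt = true) :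
    CellConclusion L Δ lam2 f cb.1 cb.2 bd ∧ mem (Tplus L Δ f - 3 * lam2) nt := by
  have hL3 : 3 ≤ L := by omega
  have hD := D_pos
  have hlam : 0 < lam2 := lam2_pos L hL3 hΔ1 hf.1
  have hΔe : Δ = deltaOfLam L lam2 := ground_delta_eq L hL hΔ0.le hΔ1 hf
  unfold xbcnCellAny2 xbcnCellAnyT2 at hok
  simp only [Bool.or_eq_true, Bool.and_eq_true, decide_eq_true_eq] at hok
  rcases hok with (⟨⟨hpos, hnum⟩, hG0⟩ | ⟨hgc, hvac⟩) | hcert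
  · exact (vacuous_of_num_neg (L := L) hL3 hlam hla hlb hpos hnum hG0 hΔ0 hΔ1 hΔe).elim
  · exfalso
    have hmd := mem_delta_cell L hL3 hlam hla hlb hgc
    rw [← hΔe] at hmd
    obtain ⟨hlo, hhi⟩ := hmd
    rcases hvac with hneg | hbig
    · have : ((((deltaIv L la lb).2 : ℤ)) : ℝ) < 0 := by exact_mod_cast hneg
      nlinarith
    · have hbig' : (d1 : ℝ) * ((D : ℤ) : ℝ) < ((((deltaIv L la lb).1 : ℤ)) : ℝ) := by
        have e : (((D : ℚ)) : ℝ) = ((D : ℤ) : ℝ) := by norm_cast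
        rw [← e]; exact_mod_cast hbig
      nlinarith
  · exact xbcn_cell_sound hL hΔ0 hΔ1 hf hla hlb hcert

end FinXB

end Summit.HubbardSuperconductivity.HubbardSuperconductivity.Theorems.AnisotropyChord.Transfer.Fibre3
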